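import Mathlib
import Literature.NumberTheory.Automorphic.ResGLnCohomology
import Literature.NumberTheory.Automorphic.CuspidalCohomologyGLShapiro
import Literature.NumberTheory.Automorphic.ArithmeticQuotientCohomologyFinite
import Literature.NumberTheory.Automorphic.GLnCuspidalSpectrumSiegel
import Literature.NumberTheory.Automorphic.ArchCoefficientModule
import Literature.Algebra.Homology.GroupCohomologyFiniteIndexModuleFinite
import HarnessLib

/-!
# Finite-dimensionality of the stabiliser cohomology `H^q(Γ_x, E_λ(ℂ))`
# (stub `stub_stabilizer_moduleFinite` of line `Sketch`)

Crux `HeckeEigenvalueField` (stmt-Langlands-13632). For a number field `K`, a nonzero ideal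
`𝔫 ⊆ 𝓞 K`, `GL_n(K)⁺ = ResGLnCohomology.glTotPos n K` of finite index in `GL_n(K)`, a weight
`λ : (K →+* ℂ) → (Fin n → ℤ)` and a coset `x ∈ GL_n(𝔸_K^∞) ⧸ K_f(𝔫)`, the cohomology
`H^q(Γ_x, E_λ(ℂ))` of the stabiliser `Γ_x = TwistedQuotient.orbitStabilizer (diagPos n K) (level n K 𝔫) x
≤ GL_n(K)⁺` with coefficients in `E_λ(ℂ) = ⨂_τ V_{λ_τ}(ℂ)` (`TwistedQuotient.stabilizerRep`) is
finite-dimensional, GIVEN the Borel–Serre statement `hBS`: for every compact open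
`U ≤ GL_n(𝔸_K^∞)`, the congruence subgroup `Γ_U = GL_n(K) ∩ U` has finite-dimensional cohomology
on finite-dimensional coefficients.  This is the input at each of the finitely many
`GL_n(K)⁺`-orbits of the Shapiro decomposition `TwistedQuotient.moduleFinite_cohomology_of_finite_cover`
of `H^q(S_{K_f(𝔫)}, Ẽ_λ)`.

Proof: with `U = Stab(x)` (compact open: the stabiliser of the coset `gK_f(𝔫)` is
`g K_f(𝔫) g⁻¹`, `TwistedQuotient.isOpen_stabilizer_coe` / `isCompact_stabilizer_coe` and
`isOpen_finitePrincipalCongruenceLevel` / `isCompact_finitePrincipalCongruenceLevel`), the group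
`Γ_x` is `Γ_U ∩ GL_n(K)⁺`, of finite index in `Γ_U`; `hBS` for `Γ_U` descends to the finite-index
subgroup `GL_n(K)⁺ ∩ Γ_U ≤ Γ_U` (`moduleFinite_groupCohomology_subgroup_of_finiteIndex`, Shapiro),
is transported along the tautological isomorphism `GL_n(K)⁺ ∩ Γ_U ≃* Γ_x`
(`moduleFinite_groupCohomology_of_mulEquiv`), and is applied to `E_λ(ℂ)`, finite-dimensional as a
finite tensor product of the finite-dimensional `V_{λ_τ}(ℂ)`
(`ParallelWeight.finiteDimensional_coeffModule`, Mathlib `PiTensorProduct.finite`).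
[cite: BorelSerre1973, Thm. 11.4.4]
-/

set_option linter.dupNamespace false -- project-wide: Summit.Langlands.Langlands is the mandated namespace

noncomputable section

open scoped Classical TensorProduct
open CategoryTheory NumberField IsDedekindDomain
open Literature.NumberTheory.Automorphic Literature.Algebra.Homology ResGLnCohomology BigHeckeGLn

namespace Summit.Langlands.Langlands.Theorems.HeckeEigenvalueField.Res

/-- `E_λ(ℂ) = ⨂_{τ : K →+* ℂ} V_{λ_τ}(ℂ)` is finite-dimensional: a finite (a number field has
finitely many complex embeddings) tensor product of the finite-dimensional `V_{λ_τ}(ℂ)`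
(`ParallelWeight.finiteDimensional_coeffModule`, Mathlib `PiTensorProduct.finite`). [folklore] -/
private theorem moduleFinite_coeffModule (n : ℕ) (K : Type) [Field K] [NumberField K]
    (lam : (K →+* ℂ) → Fin n → ℤ) : Module.Finite ℂ (CoeffModule ℂ n K lam) := by
  haveI : ∀ τ : K →+* ℂ, Module.Finite ℂ (GLnCohomology.CoeffModule ℂ n (lam τ)) :=
    fun τ => ParallelWeight.finiteDimensional_coeffModule n (lam τ)
  exact inferInstanceAs
    (Module.Finite ℂ (⨂[ℂ] τ : (K →+* ℂ), GLnCohomology.CoeffModule ℂ n (lam τ)))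

/-- **Stub 3** — each stabiliser cohomology `H^q(Γ_x, E_λ(ℂ))`, `x ∈ GL_n(𝔸_K^∞) ⧸ K_f(𝔫)`
(`𝔫 ≠ 0`, `[GL_n(K) : GL_n(K)⁺] < ∞`), is finite-dimensional, GIVEN the Borel–Serre
finite-dimensionality `hBS` of the cohomology of the congruence subgroups `Γ_U = GL_n(K) ∩ U`
(`U ≤ GL_n(𝔸_K^∞)` compact open) on finite-dimensional coefficients: `Γ_x = Γ_U ∩ GL_n(K)⁺` for
the compact open `U = Stab(x) = g K_f(𝔫) g⁻¹`, a subgroup of finite index of `Γ_U` (Shapiro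
descent `moduleFinite_groupCohomology_subgroup_of_finiteIndex`, transport
`moduleFinite_groupCohomology_of_mulEquiv`), and `E_λ(ℂ)` is finite-dimensional.
[cite: BorelSerre1973, Thm. 11.4.4] -/
theorem stub_stabilizer_moduleFinite
    (hBS : ∀ (k : Type) [Field k] (n : ℕ) (K : Type) [Field K] [NumberField K]
      (U : Subgroup (FiniteAdelicGL n K)),
      IsOpen (U : Set (FiniteAdelicGL n K)) → IsCompact (U : Set (FiniteAdelicGL n K)) →
      ∀ (A : Rep k (U.comap (globalEmbedding n K))), Module.Finite k A →
        ∀ q : ℕ, Module.Finite k (groupCohomology A q)) :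
    ∀ (n : ℕ) (K : Type) [Field K] [NumberField K] (𝔫 : Ideal (𝓞 K)), 𝔫 ≠ 0 →
      (glTotPos n K).FiniteIndex → ∀ (lam : (K →+* ℂ) → Fin n → ℤ)
      (x : FiniteAdelicGL n K ⧸ level n K 𝔫) (q : ℕ),
        Module.Finite ℂ (groupCohomology
          (TwistedQuotient.stabilizerRep (diagPos n K) (level n K 𝔫) (coeffRepPos ℂ n K lam) x) q) := by
  intro n K _ _ 𝔫 h𝔫 hfi lam x q
  -- the compact open stabiliser `U = Stab(x) = g K_f(𝔫) g⁻¹` and its congruence subgroup `Γ_U`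
  set U : Subgroup (FiniteAdelicGL n K) := MulAction.stabilizer (FiniteAdelicGL n K) x
  have hUo : IsOpen (U : Set (FiniteAdelicGL n K)) :=
    TwistedQuotient.isOpen_stabilizer_coe (level n K 𝔫)
      (isOpen_finitePrincipalCongruenceLevel n K h𝔫) x
  have hUc : IsCompact (U : Set (FiniteAdelicGL n K)) :=
    TwistedQuotient.isCompact_stabilizer_coe (level n K 𝔫)
      (isCompact_finitePrincipalCongruenceLevel n K h𝔫) x
  set ΓU : Subgroup (GL (Fin n) K) := U.comap (globalEmbedding n K)
  -- Borel–Serre for `Γ_U`, descended to the finite-index subgroup `GL_n(K)⁺ ∩ Γ_U`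
  haveI : (glTotPos n K).IsFiniteRelIndex ΓU := Subgroup.isFiniteRelIndex_of_finiteIndex
  have hS : ∀ (B : Rep ℂ ((glTotPos n K).subgroupOf ΓU)), Module.Finite ℂ B →
      ∀ m, Module.Finite ℂ (groupCohomology B m) := fun B hB m => by
    haveI := hB
    exact moduleFinite_groupCohomology_subgroup_of_finiteIndex _ (hBS ℂ n K U hUo hUc) B m
  -- the tautological isomorphism `GL_n(K)⁺ ∩ Γ_U ≃* Γ_x`: both are the elements of `GL_n(K)` with
  -- totally positive determinant fixing `x` (all memberships agree definitionally)
  have e : (glTotPos n K).subgroupOf ΓU ≃*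
      TwistedQuotient.orbitStabilizer (diagPos n K) (level n K 𝔫) x :=
    { toFun := fun s => ⟨⟨((s : ΓU) : GL (Fin n) K), s.2⟩, (s : ΓU).2⟩
      invFun := fun g => ⟨⟨((g : glTotPos n K) : GL (Fin n) K), g.2⟩, (g : glTotPos n K).2⟩
      left_inv := fun _ => rfl
      right_inv := fun _ => rfl
      map_mul' := fun _ _ => rfl }
  -- Borel–Serre transported to `Γ_x`
  have hx : ∀ (B : Rep ℂ (TwistedQuotient.orbitStabilizer (diagPos n K) (level n K 𝔫) x)),
      Module.Finite ℂ B → ∀ m, Module.Finite ℂ (groupCohomology B m) := fun B hB m => by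
    haveI := hB
    exact moduleFinite_groupCohomology_of_mulEquiv e hS B m
  -- and applied to the finite-dimensional `E_λ(ℂ)`
  exact hx _ (moduleFinite_coeffModule n K lam) q

end Summit.Langlands.Langlands.Theorems.HeckeEigenvalueField.Res

end
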